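import Mathlib
import HarnessLib
import Summits.QuantumAdvantage.QuantumAdvantage.Theorems.PumpDialI

/-!
# PumpDial J — twist law (2/3): Möbius extraction (`eq_zero_of_LfunK_far`) and the twist law `not_unityAt_of_allLive`

Lens «minimal-counterexample / extremal reduction» (decomp-qadv-lens-4, generation 26): the TWIST LAW package,
cut into chain-imported parts `PumpDialI → PumpDialJ → PumpDialK` (Theses-free: imports only `PumpDialG`,
`AdviceFreeQNC0.WalkAdaptedFarPattern`, HarnessLib, Mathlib) and the junction `PumpDialL` (imports `PumpDialH`).
The monolithic file of record (`TwistLaw.lean`, farm rc 0 · 0 sorry · axioms {propext, Classical.choice, Quot.sound})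
and the full mathematical header live in the lens folder g26; this part (LAND-REV2:
stated over the cell's `CharK.LfunK`, `CharK.sgnW`, `CharK.kapW`, `CharK.LfunK_mono`, `CharK.LfunKLin`):
the twist `twK = σ/κ` and its normalisation `norm_LfunK_mono`, the signed Möbius sums over the subcube around a top monomial, `eq_zero_of_LfunK_far`
(a degree-`d` function killed by every far functional vanishes, `3d+3 ≤ n`), and `not_unityAt_of_allLive` (no unity of degree `d` on a
board with an all-live input, `3d+3 ≤ n`, over a field with `3 ≠ 0` and a primitive cube root of unity).
-/

set_option autoImplicit false
set_option linter.dupNamespace false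

namespace Summit.QuantumAdvantage.QuantumAdvantage.Theorems.PumpDial
open Classical
open Finset
open Summit.QuantumAdvantage.AdviceFreeQNC0
open Summit.QuantumAdvantage.AdviceFreeQNC0.CharK
open Literature.Computability.MetaComplexity Literature.Computability.MetaComplexity.Smolensky

/-! ## The Möbius step: extracting a top coefficient with far patterns -/
section Moebius
variable {L : Type*} [Field L] {n : ℕ}

/-- the twist of a letter: `τ(x) = σ(x)·κ(x)⁻¹` (`σ = CharK.sgnW`, `κ = CharK.kapW`), i.e.
`τ(1) = (1 − ω²)⁻¹`, `τ(2) = (1 − ω)⁻¹`. -/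
noncomputable def twK (ω : L) (x : Bool) : L := sgnW x * (kapW ω x)⁻¹

/-- `τ(x) = (1 − ω^{lett ¬x})⁻¹`. -/
theorem twK_eq_inv (ω : L) (x : Bool) : twK ω x = (1 - ω ^ lett (!x))⁻¹ := by
  unfold twK sgnW kapW lett
  cases x
  · simp
  · simp only [if_true, Bool.not_true, Bool.false_eq_true, if_false, pow_one]
    rw [neg_one_mul, ← inv_neg, neg_sub]

/-- `τ(2) ≠ τ(1)` (`ω ≠ ω²`). -/
theorem twK_true_ne_false {ω : L} (hω : ω ^ 2 + ω + 1 = 0) (h3 : (3 : L) ≠ 0) : twK ω true ≠ twK ω false := by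
  rw [twK_eq_inv, twK_eq_inv]
  unfold lett
  simp only [Bool.not_true, Bool.false_eq_true, if_false, pow_one, Bool.not_false, if_true]
  intro h
  apply omega_sub_ne_zero hω h3
  linear_combination -(inv_injective h)

/-- **the normalised transform of a monomial is a product over the monomial**:
`(Π_i κ(a_i))⁻¹ · L_a(u^S) = Π_{i ∈ S} τ(a_i)` (from `CharK.LfunK_mono`). -/
theorem norm_LfunK_mono {ω : L} (hω : ω ^ 2 + ω + 1 = 0) (h3 : (3 : L) ≠ 0) (a : Fin n → Bool)
    (S : Finset (Fin n)) : (∏ i, kapW ω (a i))⁻¹ * LfunK ω a (mono L S) = ∏ i ∈ S, twK ω (a i) := by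
  classical
  rw [LfunK_mono, ← Finset.prod_sdiff (Finset.subset_univ S)]
  unfold twK
  have hS' : ∏ i ∈ univ \ S, kapW ω (a i) ≠ 0 := Finset.prod_ne_zero_iff.2 fun i _ => kapW_ne_zero hω h3 (a i)
  rw [Finset.prod_mul_distrib, Finset.prod_inv_distrib, mul_inv]
  calc (∏ i ∈ univ \ S, kapW ω (a i))⁻¹ * (∏ i ∈ S, kapW ω (a i))⁻¹ *
        ((∏ i ∈ S, sgnW (a i)) * ∏ i ∈ univ \ S, kapW ω (a i))
      = (∏ i ∈ univ \ S, kapW ω (a i))⁻¹ * (∏ i ∈ univ \ S, kapW ω (a i)) *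
          ((∏ i ∈ S, sgnW (a i)) * (∏ i ∈ S, kapW ω (a i))⁻¹) := by ring
    _ = (∏ i ∈ S, sgnW (a i)) * (∏ i ∈ S, kapW ω (a i))⁻¹ := by rw [inv_mul_cancel₀ hS', one_mul]

/-- flipping on `insert j T` agrees with flipping on `T` away from `j`. -/
theorem flipOn_insert_of_ne' {T : Finset (Fin n)} {i j : Fin n} (hij : i ≠ j) (a : Fin n → Bool) :
    flipOn (insert j T) a i = flipOn T a i := by
  classical
  simp [flipOn, Finset.mem_insert, hij]

/-- **cancellation**: if `S` misses a point `j` of `S₀`, the SIGNED twisted products over the subcube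
`{σ_T b : T ⊆ S₀}` cancel in pairs `T ↔ T ∪ {j}`. -/
theorem sum_powerset_sign_prod_twK_eq_zero (ω : L) {S S₀ : Finset (Fin n)} {j : Fin n} (hj : j ∈ S₀)
    (hjS : j ∉ S) (b : Fin n → Bool) :
    ∑ T ∈ S₀.powerset, (-1 : L) ^ T.card * ∏ i ∈ S, twK ω (flipOn T b i) = 0 := by
  classical
  have hS₀ : S₀ = insert j (S₀.erase j) := (Finset.insert_erase hj).symm
  rw [hS₀, Finset.sum_powerset_insert (Finset.notMem_erase j S₀), ← Finset.sum_add_distrib]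
  refine Finset.sum_eq_zero fun T hT => ?_
  have hjT : j ∉ T := fun h => Finset.notMem_erase j S₀ (Finset.mem_powerset.1 hT h)
  have e : ∏ i ∈ S, twK ω (flipOn (insert j T) b i) = ∏ i ∈ S, twK ω (flipOn T b i) := by
    refine Finset.prod_congr rfl fun i hi => ?_
    have hij : i ≠ j := fun h => hjS (h ▸ hi)
    rw [flipOn_insert_of_ne' hij]
  rw [e, Finset.card_insert_of_notMem hjT, pow_succ]
  ring

/-- **the top term**: over the subcube the signed twisted products over `S₀` itself multiply out to
`Π_{i ∈ S₀} (τ(b_i) − τ(¬b_i))`. -/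
theorem sum_powerset_sign_prod_twK_self (ω : L) (S₀ : Finset (Fin n)) (b : Fin n → Bool) :
    ∑ T ∈ S₀.powerset, (-1 : L) ^ T.card * ∏ i ∈ S₀, twK ω (flipOn T b i) =
      ∏ i ∈ S₀, (twK ω (b i) - twK ω (!b i)) := by
  classical
  have h := Finset.prod_add (fun i => -twK ω (!b i)) (fun i => twK ω (b i)) S₀
  have e0 : ∏ i ∈ S₀, (twK ω (b i) - twK ω (!b i)) =
      ∏ i ∈ S₀, (-twK ω (!b i) + twK ω (b i)) := Finset.prod_congr rfl fun i _ => by ring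
  rw [e0, h]
  refine Finset.sum_congr rfl fun T hT => ?_
  have hTS : T ⊆ S₀ := Finset.mem_powerset.1 hT
  rw [← Finset.prod_sdiff hTS]
  have e1 : ∏ i ∈ T, -twK ω (!b i) = (-1 : L) ^ T.card * ∏ i ∈ T, twK ω (flipOn T b i) := by
    rw [← Finset.prod_const, ← Finset.prod_mul_distrib]
    refine Finset.prod_congr rfl fun i hi => ?_
    unfold flipOn
    rw [if_pos hi]; ring
  have e2 : ∏ i ∈ S₀ \ T, twK ω (b i) = ∏ i ∈ S₀ \ T, twK ω (flipOn T b i) := by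
    refine Finset.prod_congr rfl fun i hi => ?_
    unfold flipOn
    rw [if_neg (Finset.mem_sdiff.1 hi).2]
  rw [e1, e2]
  ring

/-- **COEFFICIENT EXTRACTION** (the cell's interpolation step in a general field): on `n ≥ 3d + 3` bits, a
polynomial `q` of degree `≤ d` killed by `L_a` for every pattern `a` with `a` and `ā` at distance `> d` from the
path is zero.  Möbius step over `{σ_T altAlong([n] ∖ S₀) : T ⊆ S₀}` at a top monomial `S₀`. -/
theorem eq_zero_of_LfunK_far {ω : L} (hω : ω ^ 2 + ω + 1 = 0) (h3 : (3 : L) ≠ 0) {d : ℕ}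
    (hn : 3 * d + 3 ≤ n) {q : CubeFn L n} (hq : q ∈ lowDeg L n d)
    (hfar : ∀ a : Fin n → Bool, ¬ NearPath d a → ¬ NearPath d (conj a) → LfunK ω a q = 0) : q = 0 := by
  classical
  have hq' := hq
  rw [lowDeg_eq_span] at hq'
  obtain ⟨cf, hc⟩ := Finsupp.mem_span_range_iff_exists_finsupp.1 hq'
  by_contra hne
  have hc0 : cf.support.Nonempty := by
    rw [Finset.nonempty_iff_ne_empty, ne_eq, Finsupp.support_eq_empty]
    rintro rfl
    apply hne
    rw [← hc]
    simp
  -- a monomial of maximal degree in the support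
  obtain ⟨σ₀, hσ₀, hmax⟩ := Finset.exists_max_image cf.support (fun σ => σ.1.card) hc0
  set S₀ : Finset (Fin n) := σ₀.1 with hS₀
  have hS₀D : S₀.card ≤ d := σ₀.2
  -- the normalised transform of `q` at a pattern `a`
  have hLQ : ∀ a : Fin n → Bool, (∏ i, kapW ω (a i))⁻¹ * LfunK ω a q =
      ∑ σ ∈ cf.support, cf σ * ∏ i ∈ σ.1, twK ω (a i) := by
    intro a
    have eQ : q = ∑ σ ∈ cf.support, cf σ • mono L σ.1 := by rw [← hc]; rfl
    rw [eQ, ← LfunKLin_apply, map_sum, Finset.mul_sum]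
    refine Finset.sum_congr rfl fun σ _ => ?_
    rw [map_smul, smul_eq_mul, LfunKLin_apply, mul_left_comm, norm_LfunK_mono hω h3]
  -- the base pattern: alternate along the complement of `S₀`
  set b : Fin n → Bool := altAlong (univ \ S₀) with hb
  have hzero : ∀ T ∈ S₀.powerset, ∑ σ ∈ cf.support, cf σ * ∏ i ∈ σ.1, twK ω (flipOn T b i) = 0 := by
    intro T hT
    have hm : 2 * 0 + 3 * d + 3 ≤ n := by omega
    obtain ⟨hf1, hf2⟩ := far_flipOn_altAlong (D := 0) (D' := d) hm hS₀D (Finset.mem_powerset.1 hT)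
    rw [← hLQ, hfar _ (by simpa using hf1) (by simpa using hf2), mul_zero]
  -- signed sum over the subcube: only the top monomial survives
  have hsum : ∑ T ∈ S₀.powerset, (-1 : L) ^ T.card *
      ∑ σ ∈ cf.support, cf σ * ∏ i ∈ σ.1, twK ω (flipOn T b i) =
        cf σ₀ * ∏ i ∈ S₀, (twK ω (b i) - twK ω (!b i)) := by
    have e1 : ∀ T ∈ S₀.powerset, (-1 : L) ^ T.card * ∑ σ ∈ cf.support, cf σ * ∏ i ∈ σ.1, twK ω (flipOn T b i) =
        ∑ σ ∈ cf.support, cf σ * ((-1 : L) ^ T.card * ∏ i ∈ σ.1, twK ω (flipOn T b i)) := by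
      intro T _
      rw [Finset.mul_sum]
      exact Finset.sum_congr rfl fun σ _ => by ring
    rw [Finset.sum_congr rfl e1, Finset.sum_comm]
    have inner : ∀ σ ∈ cf.support, ∑ T ∈ S₀.powerset, cf σ * ((-1 : L) ^ T.card * ∏ i ∈ σ.1, twK ω (flipOn T b i)) =
        if σ = σ₀ then cf σ₀ * ∏ i ∈ S₀, (twK ω (b i) - twK ω (!b i)) else 0 := by
      intro σ hσ
      rw [← Finset.mul_sum]
      by_cases hσσ : σ = σ₀
      · rw [if_pos hσσ, hσσ, sum_powerset_sign_prod_twK_self]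
      · rw [if_neg hσσ]
        have hnot : ¬ S₀ ⊆ σ.1 := by
          intro hsub
          have hle := hmax σ hσ
          have heq : S₀ = σ.1 := Finset.eq_of_subset_of_card_le hsub hle
          exact hσσ (Subtype.ext heq.symm)
        obtain ⟨j, hj, hjσ⟩ := Finset.not_subset.1 hnot
        rw [sum_powerset_sign_prod_twK_eq_zero ω hj hjσ, mul_zero]
    rw [Finset.sum_congr rfl inner, Finset.sum_ite_eq' cf.support σ₀, if_pos hσ₀]
  rw [Finset.sum_congr rfl fun T hT => by rw [hzero T hT, mul_zero], Finset.sum_const_zero] at hsum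
  have hcσ : cf σ₀ ≠ 0 := Finsupp.mem_support_iff.1 hσ₀
  have htop : ∏ i ∈ S₀, (twK ω (b i) - twK ω (!b i)) ≠ 0 := by
    refine Finset.prod_ne_zero_iff.2 fun i _ => ?_
    have hne' : twK ω (b i) ≠ twK ω (!b i) := by
      cases b i
      · exact (twK_true_ne_false hω h3).symm
      · exact twK_true_ne_false hω h3
    exact sub_ne_zero.2 hne'
  exact mul_ne_zero hcσ htop hsum.symm

end Moebius

/-! ## The twist law -/
section Twist
variable {L : Type*} [Field L] {n : ℕ}

/-- **THE TWIST LAW.**  Over a field with `3 ≠ 0` and a cube root of unity `ω`, a board `(n, c)` with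
`3d + 3 ≤ n` and an input at which every cut is live carries no unity of degree `d`. -/
theorem not_unityAt_of_allLive {ω : L} (hω : ω ^ 2 + ω + 1 = 0) (h3 : (3 : L) ≠ 0) {c d : ℕ}
    (hn : 3 * d + 3 ≤ n) {u₀ : Fin n → Bool}
    (hlive : ∀ g : Fin (n + 1), (c + g.val + walkExp u₀ g.val) % 3 ≠ 0) : ¬ UnityAt L n c d := by
  classical
  rintro ⟨Y, hY, hunit⟩
  -- `q = 2·Σ_g Y_g − 3`
  set q : CubeFn L n := fun u => 2 * (∑ g, Y g u) - 3 with hqdef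
  have hq_low : q ∈ lowDeg L n d := by
    have h1 : (∑ g, Y g) ∈ lowDeg L n d := Submodule.sum_mem _ fun g _ => hY g
    have e : q = (2 : L) • (∑ g, Y g) - fun _ => (3 : L) := by
      funext u
      simp only [hqdef, Pi.sub_apply, Pi.smul_apply, Finset.sum_apply, smul_eq_mul]
    rw [e]
    exact Submodule.sub_mem _ (Submodule.smul_mem _ _ h1) (const_mem_lowDeg 3 d)
  -- pointwise: `q = Σ_g (ω^{c+g} Y_g χ_{a^{(g)}} + ω^{2(c+g)} Y_g χ̄_{a^{(g)}})`
  have hq_pt : ∀ u, q u = ∑ g : Fin (n + 1), (ω ^ (c + g.val) * (Y g u * chiK ω (aPat g.val) u) +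
      ω ^ (2 * (c + g.val)) * (Y g u * chiK ω (conj (aPat g.val)) u)) := by
    intro u
    have e : ∀ g : Fin (n + 1), Y g u * ((3 : L) * liveInd L c g u) = 2 * Y g u -
        (ω ^ (c + g.val) * (Y g u * chiK ω (aPat g.val) u) +
          ω ^ (2 * (c + g.val)) * (Y g u * chiK ω (conj (aPat g.val)) u)) := by
      intro g
      rw [three_mul_liveInd hω c g u, mul_add 2 (c + g.val) (walkExp u g.val), pow_add ω (c + g.val) (walkExp u g.val),
        pow_add ω (2 * (c + g.val)) (2 * walkExp u g.val), omega_pow_walkExp_K, omega_pow_two_mul_walkExp hω]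
      ring
    have h3s : ∑ g, Y g u * ((3 : L) * liveInd L c g u) = 3 := by
      have : ∑ g, Y g u * ((3 : L) * liveInd L c g u) = 3 * ∑ g, Y g u * liveInd L c g u := by
        rw [Finset.mul_sum]; exact Finset.sum_congr rfl fun g _ => by ring
      rw [this, hunit u, mul_one]
    rw [Finset.sum_congr rfl fun g _ => e g, Finset.sum_sub_distrib, ← Finset.mul_sum] at h3s
    simp only [hqdef]
    linear_combination h3s
  -- `L_a(q) = 0` for every far pattern `a`
  have hfar : ∀ a : Fin n → Bool, ¬ NearPath d a → ¬ NearPath d (conj a) → LfunK ω a q = 0 := by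
    intro a ha hca
    have eq : q = ∑ g : Fin (n + 1), ((ω ^ (c + g.val)) • (fun u => Y g u * chiK ω (aPat g.val) u) +
        (ω ^ (2 * (c + g.val))) • (fun u => Y g u * chiK ω (conj (aPat g.val)) u)) := by
      funext u
      rw [hq_pt u, Finset.sum_apply]
      simp only [Pi.add_apply, Pi.smul_apply, smul_eq_mul]
    rw [eq, ← LfunKLin_apply, map_sum]
    refine Finset.sum_eq_zero fun g _ => ?_
    have d1 : d < pdist a (aPat g.val) := not_le.1 fun h => ha ⟨g.val, h⟩
    have d2 : d < pdist a (conj (aPat g.val)) := by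
      rw [TwoShot.pdist_conj_comm]; exact not_le.1 fun h => hca ⟨g.val, h⟩
    rw [map_add, map_smul, map_smul, LfunKLin_apply, LfunKLin_apply, smul_eq_mul, smul_eq_mul,
      LfunK_lowDeg_mul_chiK ω (hY g) _ _ d1, LfunK_lowDeg_mul_chiK ω (hY g) _ _ d2, mul_zero, mul_zero, zero_add]
  have hq0 : q = 0 := eq_zero_of_LfunK_far hω h3 hn hq_low hfar
  -- but `q(u₀) = 2·1 − 3 = −1`
  have hS : ∑ g, Y g u₀ = 1 := by
    rw [← hunit u₀]
    refine Finset.sum_congr rfl fun g _ => ?_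
    unfold liveInd
    rw [if_pos (hlive g), mul_one]
  have h0 : q u₀ = 0 := by rw [hq0]; rfl
  simp only [hqdef, hS] at h0
  apply h3
  linear_combination (-3 : L) * h0

end Twist

end Summit.QuantumAdvantage.QuantumAdvantage.Theorems.PumpDial
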